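import Summits.PneNP.PneNP.Theorems.Sd2BlMachineGreedy
import Summits.PneNP.PneNP.Theorems.SfmBlMachineGreedyFP

/-!
# Sign-degree-2 engine, MACHINE LAYER G6 (typing): the sign-degree-2 signing is a polynomial-time string
# function (cell pnp-ideate, ROUND-18 item K1'' `SignDeg2Signing.SignDeg2SigningFP`, stage S3)

FRONTIER (range avoidance for sign-degree-≤2 local maps at linear stretch; restricted-model algorithmic
rung); nothing here bears on P vs NP.

`CodeFP` typings of the spec `Sd2BlMachineGreedy`, twin of `SfmBlMachineGreedyFP` with the context
`(m, plegs)` (`m` in unary, the pieced legs in binary) in place of `(m, trips)` and the constants as functions of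
the machine parameters `(ℓ, t)`: every parameter / cap / static datum of the context (`cN…`, `cCands`, `cExtract`,
`cRlegs`, `cRecs`, `cV`, `cC₁`, `cC₂`; caps and round counts in UNARY through `unitsPow`, clamped numerals through
`unOfNatMin`), the per-step potential `codeFP_gPot`, the step and the loop (`CodeFP.foldl`, accumulator = the
bits), `codeFP_sd2Bits`; composed with G1 `codeFP_pieceLegsG`, G2 `codeFP_rawLegsDecode` and prover-1's header
reader `codeFP_hdrM`: **`codeFP_sd2Str`**, **`sd2Str_mem_FP`**, **`isPolyTime_sd2Str`** for ALL tables `F0 F1 F2`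
and parameters `ℓ t`.
-/

set_option linter.dupNamespace false -- `Summit.PneNP.PneNP.…`: summit = sub-problem name (D-0017 single-conjunct layout)

namespace Summit.PneNP.PneNP.Theorems.Sd2BlMachine

open Literature.Computability.Complexity CodeFP
open Summit.PneNP.PneNP.Theorems.SfmBlMachine
open Summit.PneNP.PneNP.Theorems.LocalMapDecodeFP (decode hdrM codeFP_hdrM)

section PolyTime

open Polynomial

variable (ℓ t : ℕ)

/-- Code of the context `(m, plegs)` (`m` in unary, pieced legs in binary). -/
abbrev σE : ℕ × List PLeg → List Bool := pairE unE (rawE plegE)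

/-- The pieced legs. -/
theorem cPlegs : CodeFP σE (rawE plegE) (fun c => c.2) := snd _ _

/-- `N` in binary. -/
theorem cNn : CodeFP σE natE (fun c => gN c.2) := ((natLength labE).comp (codeFP_pieces.comp cPlegs)).congr fun _ => rfl

/-- `N` in unary. -/
theorem cNu : CodeFP σE unE (fun c => gN c.2) := ((ulength labE).comp (codeFP_pieces.comp cPlegs)).congr fun _ => rfl

/-- `40N` in binary. -/
theorem c40Nn : CodeFP σE natE (fun c => 40 * gN c.2) := (natMul.comp ((const _ (40 : ℕ)).pair cNn)).congr fun _ => rfl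

/-- `40N` in unary. -/
theorem c40Nu : CodeFP σE unE (fun c => 40 * gN c.2) := ((unMulConst 40).comp cNu).congr fun _ => rfl

/-- `j + 1` in unary. -/
theorem cJ1u : CodeFP σE unE (fun c => pJ1 (gN c.2)) :=
  (Literature.Computability.QuantumComplexity.natSizeU_codeFP.comp (Literature.Computability.Complexity.SatCode.natSize_code.comp
    (natMul.comp ((const _ (20 : ℕ)).pair cNn)))).congr fun _ => rfl

/-- `2^(j+1)` in binary. -/
theorem c2J1 : CodeFP σE natE (fun c => 2 ^ pJ1 (gN c.2)) :=
  (natPow.comp ((const _ (2 : ℕ)).pair cJ1u)).congr fun _ => by dsimp only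

/-- `t₀` in binary. -/
theorem cT0 : CodeFP σE natE (fun c => pT0 (gN c.2)) :=
  (natDiv.comp ((natAdd.comp ((natMul.comp ((const _ (4 : ℕ)).pair c2J1)).pair
    (natMul.comp ((const _ (2 : ℕ)).pair (Literature.Computability.Complexity.SatCode.natSize_code.comp cNn))))).pair
    (const _ (10 : ℕ)))).congr fun _ => rfl

/-- `t₀'` in binary. -/
theorem cT0' : CodeFP σE natE (fun c => pT0' (gN c.2)) := (natMin.comp (cT0.pair c40Nn)).congr fun _ => rfl

/-- `t₀'` in unary (the clamp makes the conversion exact). -/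
theorem cT0'u : CodeFP σE unE (fun c => pT0' (gN c.2)) :=
  (unOfNatMin.comp (c40Nu.pair cT0')).congr fun c => min_eq_left (by unfold pT0'; exact min_le_right _ _)

/-- `q + 1` (clamped) in binary. -/
theorem cQ1' : CodeFP σE natE (fun c => pQ1' (gN c.2)) := (natMin.comp (c2J1.pair c40Nn)).congr fun _ => rfl

/-- `q + 1` (clamped) in unary. -/
theorem cQ1'u : CodeFP σE unE (fun c => pQ1' (gN c.2)) :=
  (unOfNatMin.comp (c40Nu.pair cQ1')).congr fun c => min_eq_left (by unfold pQ1'; exact min_le_right _ _)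

/-- The rounds `2(t₀' − 1)` of the candidate walks, as units. -/
theorem cUW : CodeFP σE (rawE unitE) (fun c => List.replicate (2 * (pT0' (gN c.2) - 1)) ()) := by
  have hn : CodeFP σE natE (fun c => 2 * (pT0' (gN c.2) - 1)) :=
    (natMul.comp ((const _ (2 : ℕ)).pair (natSub.comp (cT0'.pair (const _ (1 : ℕ)))))).congr fun _ => rfl
  have hu : CodeFP σE unE (fun c => 2 * (pT0' (gN c.2) - 1)) :=
    (unOfNatMin.comp (((unMulConst 2).comp cT0'u).pair hn)).congr fun c => min_eq_left (by omega)
  exact (replicateUnit.comp hu).congr fun _ => rfl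

/-- The walk cap `(40N)^(4t+1)` in unary. -/
theorem cCapWu : CodeFP σE unE (fun c => gCapW t c.2) :=
  ((ulength unitE).comp ((unitsPow (4 * t + 1)).comp c40Nu)).congr fun c => by
    show (List.replicate ((40 * gN c.2) ^ (4 * t + 1)) ()).length = gCapW t c.2
    rw [List.length_replicate]; rfl

/-- The candidate pairs. -/
theorem cCands : CodeFP σE (rawE candE) (fun c => gCands t c.2) :=
  (codeFP_cands.comp (((cPlegs.pair (cCapWu t)).pair cUW).pair cT0')).congr fun _ => rfl

/-- The extraction output. -/
theorem cExtract : CodeFP σE xstE (fun c => gExtract ℓ t c.2) := by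
  have hr : CodeFP σE (rawE unitE) (fun c => List.replicate (c.2.length + 1) ()) :=
    (replicateUnit.comp (unSucc.comp ((ulength plegE).comp cPlegs))).congr fun _ => rfl
  exact (codeFP_extract.comp (((cPlegs.pair (cCands t)).pair (const _ (gRsq ℓ t))).pair hr)).congr fun _ => rfl

/-- The labels. -/
theorem cLabels : CodeFP σE (rawE natE) (fun c => (gExtract ℓ t c.2).1) := (cExtract ℓ t).fst'

/-- `r'` in binary. -/
theorem cR'n : CodeFP σE natE (fun c => gR' ℓ t c.2) :=
  (natMin.comp ((cExtract ℓ t).snd'.pair (natAdd.comp (((natLength plegE).comp cPlegs).pair (const _ (1 : ℕ)))))).congr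
    fun _ => rfl

/-- `r'` in unary (the clamp makes the conversion exact). -/
theorem cR'u : CodeFP σE unE (fun c => gR' ℓ t c.2) :=
  (unOfNatMin.comp ((unSucc.comp ((ulength plegE).comp cPlegs)).pair (cR'n ℓ t))).congr fun c =>
    min_eq_left (by unfold gR'; exact min_le_right _ _)

/-- The remainder legs. -/
theorem cRlegs : CodeFP σE (rawE plegE) (fun c => gRlegs ℓ t c.2) :=
  (codeFP_rlegs.comp (cPlegs.pair (cLabels ℓ t))).congr fun _ => rfl

/-- The rounds `2(q+1) − 1` of the alternating sequences, as units. -/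
theorem cUA : CodeFP σE (rawE unitE) (fun c => gUA c.2) := by
  have hn : CodeFP σE natE (fun c => 2 * pQ1' (gN c.2) - 1) :=
    (natSub.comp ((natMul.comp ((const _ (2 : ℕ)).pair cQ1')).pair (const _ (1 : ℕ)))).congr fun _ => rfl
  have hu : CodeFP σE unE (fun c => 2 * pQ1' (gN c.2) - 1) :=
    (unOfNatMin.comp (((unMulConst 2).comp cQ1'u).pair hn)).congr fun c => min_eq_left (by omega)
  exact (replicateUnit.comp hu).congr fun _ => rfl

/-- The alternating-sequence cap `|plegs|·(40N)^(8t)` in unary. -/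
theorem cCapAu : CodeFP σE unE (fun c => gCapA t c.2) :=
  ((ulength unitE).comp (unitsMul.comp ((replicateUnit.comp ((ulength plegE).comp cPlegs)).pair
    ((unitsPow (8 * t)).comp c40Nu)))).congr fun c => by
      show (List.replicate ((List.replicate c.2.length ()).length * (List.replicate ((40 * gN c.2) ^ (8 * t)) ()).length) ()).length
        = gCapA t c.2
      simp only [List.length_replicate]; rfl

/-- The sublist cap `40N` in unary. -/
theorem cCapSu : CodeFP σE unE (fun c => gCapS c.2) := c40Nu

/-- The pair records of all spots. -/
theorem cRecs : CodeFP σE (rawE precE) (fun c => gRecs ℓ t c.2) :=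
  (codeFP_allRecs.comp ((cCapSu.pair (cCapWu t)).pair ((cPlegs.pair (cLabels ℓ t)).pair (cR'u ℓ t)))).congr fun _ => rfl

/-- `V = Σ_s (|V₁ s| + |V₂ s|)` in binary. -/
theorem cV : CodeFP σE natE (fun c => gV ℓ t c.2) := by
  have hs : CodeFP (pairE (pairE (rawE plegE) (rawE natE)) natE) natE
      (fun q => (lpieces (slegs q.1.1 q.1.2 q.2)).length + (rpieces (slegs q.1.1 q.1.2 q.2)).length) :=
    (natAdd.comp ((((natLength labE).comp (codeFP_lpieces.comp codeFP_slegs))).pair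
      ((natLength labE).comp (codeFP_rpieces.comp codeFP_slegs)))).congr fun _ => rfl
  exact (natSum.comp ((map hs).comp ((cPlegs.pair (cLabels ℓ t)).pair (urange.comp (cR'u ℓ t))))).congr fun _ => rfl

/-- `ℓ' = 2(q+1)` in unary. -/
theorem cEllu : CodeFP σE unE (fun c => gEll c.2) := ((unMulConst 2).comp cQ1'u).congr fun _ => rfl

/-- `R^ℓ'` in binary. -/
theorem cRadPow : CodeFP σE natE (fun c => gRad ℓ t ^ gEll c.2) :=
  (natPow.comp ((const _ (gRad ℓ t)).pair cEllu)).congr fun _ => by dsimp only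

/-- `C₁` in binary. -/
theorem cC₁ : CodeFP σE natE (fun c => gC₁ ℓ t c.2) :=
  (natMul.comp ((const _ (6 : ℕ)).pair (natAdd.comp ((natMul.comp ((const _ (4 : ℕ)).pair (cV ℓ t))).pair
    (const _ ((gL t) ^ 10 : ℕ)))))).congr fun _ => rfl

/-- `C₂` in binary. -/
theorem cC₂ : CodeFP σE natE (fun c => gC₂ ℓ t c.2) :=
  (natMul.comp ((natMul.comp ((const _ (50 : ℕ)).pair (const _ ((gL t) ^ 10 : ℕ)))).pair
    (natAdd.comp ((natMul.comp (cNn.pair (cRadPow ℓ t))).pair (const _ (1 : ℕ)))))).congr fun _ => rfl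

/-- Code of the step input `((m, plegs), (kk, T₀))`. -/
abbrev stE : (ℕ × List PLeg) × (ℕ × List Bool) → List Bool := pairE σE (pairE natE (rawE bitE))

/-- **The scaled potential is polynomial time** (input `((m, plegs), (kk, T₀))`). -/
theorem codeFP_gPot : CodeFP stE intE (fun q => gPot ℓ t q.1.1 q.1.2 q.2.1 q.2.2) := by
  have hen : CodeFP stE natE (fun q => q.1.1 - q.2.1 + 1) :=
    (natAdd.comp ((natSub.comp ((natOfUn.comp (fst _ _).fst').pair (snd _ _).fst')).pair (const _ (1 : ℕ)))).congr
      fun _ => rfl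
  have heu : CodeFP stE unE (fun q => q.1.1 - q.2.1 + 1) :=
    (unOfNatMin.comp ((unSucc.comp (fst _ _).fst').pair hen)).congr fun q => min_eq_left (by omega)
  have hpw : CodeFP stE intE (fun q => (2 : ℤ) ^ (q.1.1 - q.2.1 + 1)) :=
    (intPow.comp ((const _ (2 : ℤ)).pair heu)).congr fun _ => by dsimp only
  have hts : CodeFP stE intE (fun q => traceSum q.2.1 q.2.2 (2 ^ (q.1.1 - q.2.1 + 1)) (gRlegs ℓ t q.1.2) (gCapA t q.1.2) (gUA q.1.2)) :=
    (codeFP_traceSum.comp (((((cRlegs ℓ t).comp (fst _ _)).pair ((cCapAu t).comp (fst _ _))).pair (cUA.comp (fst _ _))).pair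
      ((snd _ _).pair hpw))).congr fun q => by dsimp only
  have hhs : CodeFP stE intE (fun q => (hatSum (gG ℓ t) q.2.1 q.2.2 q.1.1 (gRecs ℓ t q.1.2) : ℤ)) :=
    (intOfNat.comp (codeFP_hatSum.comp ((((const _ (gG ℓ t)).pair (snd _ _).fst').pair ((snd _ _).snd'.pair (fst _ _).fst')).pair
      ((cRecs ℓ t).comp (fst _ _))))).congr fun _ => rfl
  exact (intAdd.comp ((intMul.comp ((intOfNat.comp ((cC₁ ℓ t).comp (fst _ _))).pair hts)).pair
    (intMul.comp ((intOfNat.comp ((cC₂ ℓ t).comp (fst _ _))).pair hhs)))).congr fun q => by unfold gPot; dsimp only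

/-- **One greedy step is polynomial time** (input `((m, plegs), ((), acc))`, the shape of `CodeFP.foldl`). -/
theorem codeFP_greedyStepP : CodeFP (pairE σE (pairE unitE (rawE bitE))) (rawE bitE)
    (fun q => greedyStepP (gPot ℓ t q.1.1 q.1.2) q.2.2) := by
  have hacc : CodeFP (pairE σE (pairE unitE (rawE bitE))) (rawE bitE) (fun q => q.2.2) := (snd _ _).snd'
  have hkk : CodeFP (pairE σE (pairE unitE (rawE bitE))) natE (fun q => q.2.2.length + 1) :=
    (natAdd.comp (((natLength bitE).comp hacc).pair (const _ (1 : ℕ)))).congr fun _ => rfl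
  have hext : ∀ b : Bool, CodeFP (pairE σE (pairE unitE (rawE bitE))) (rawE bitE) (fun q => q.2.2 ++ [b]) := fun b =>
    ((rawAppend bitE).comp (hacc.pair (const _ [b]))).congr fun _ => rfl
  have hpot : ∀ b : Bool, CodeFP (pairE σE (pairE unitE (rawE bitE))) intE
      (fun q => gPot ℓ t q.1.1 q.1.2 (q.2.2.length + 1) (q.2.2 ++ [b])) := fun b =>
    ((codeFP_gPot ℓ t).comp ((fst _ _).pair (hkk.pair (hext b)))).congr fun _ => rfl
  exact ((intLe.comp ((hpot false).pair (hpot true))).ite (hext false) (hext true)).congr fun q => by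
    unfold greedyStepP
    simp only [decide_eq_true_eq]

/-- **The greedy loop is polynomial time** (input `((m, plegs), u)`; accumulator = the bits, one per step). -/
theorem codeFP_greedyRunP : CodeFP (pairE σE (rawE unitE)) (rawE bitE) (fun p => greedyRunP (gPot ℓ t p.1.1 p.1.2) p.2) := by
  have h := foldl (σ := ℕ × List PLeg) (α := Unit) (β := List Bool) (eσ := σE) (eα := unitE) (eβ := rawE bitE)
    (step := fun s _ acc => greedyStepP (gPot ℓ t s.1 s.2) acc) (init := fun _ => []) (codeFP_greedyStepP ℓ t)
    (const σE ([] : List Bool))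
    (4 * X) (fun s l₁ l₂ => by
      set n := (pairE σE (rawE unitE) (s, l₁ ++ l₂)).length with hn
      have hl₁ : l₁.length ≤ n := by
        have := length_le_length_rawE unitE (l₁ ++ l₂)
        rw [List.length_append] at this
        rw [hn]; simp only [pairE_apply, length_boolPair]; omega
      have hlen : (l₁.foldl (fun acc (_ : Unit) => greedyStepP (gPot ℓ t s.1 s.2) acc) []).length = l₁.length :=
        length_greedyRunP _ l₁
      have hitem : ∀ b ∈ l₁.foldl (fun acc (_ : Unit) => greedyStepP (gPot ℓ t s.1 s.2) acc) [], (bitE b).length ≤ 1 :=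
        fun b _ => by simp [bitE]
      have h1 := length_rawE_le_of_forall hitem
      rw [hlen] at h1
      have heval : (4 * X : Polynomial ℕ).eval n = 4 * n := by simp
      show (rawE bitE (l₁.foldl (fun acc (_ : Unit) => greedyStepP (gPot ℓ t s.1 s.2) acc) [])).length ≤ _
      rw [heval]; omega)
  exact h.congr fun p => rfl

/-- **The sign-degree-2 signing of `(m, plegs)` is polynomial time.** -/
theorem codeFP_sd2Bits : CodeFP σE (rawE bitE) (fun c => sd2Bits ℓ t c.1 c.2) :=
  ((codeFP_greedyRunP ℓ t).comp ((CodeFP.id σE).pair (replicateUnit.comp (fst _ _)))).congr fun _ => rfl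

variable (k : ℕ) (F0 : ((Fin k → Bool) → Bool) → ℤ) (F1 : ((Fin k → Bool) → Bool) → Fin k → ℤ)
  (F2 : ((Fin k → Bool) → Bool) → Fin k → Fin k → ℤ)

/-- **THE MACHINE IS A POLYNOMIAL-TIME STRING FUNCTION** (`strE = id` on both sides). -/
theorem codeFP_sd2Str : CodeFP strE strE (sd2Str k F0 F1 F2 ℓ t) := by
  have hctx : CodeFP strE σE (fun w => (hdrM w, pieceLegsG (gL t) (rawLegs k F0 F1 F2 (decode k w)))) :=
    codeFP_hdrM.pair ((codeFP_pieceLegsG (gL t)).comp (codeFP_rawLegsDecode k F0 F1 F2))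
  exact (bitsToStr.comp ((codeFP_sd2Bits ℓ t).comp hctx)).congr fun _ => rfl

/-- **`sd2Str … ∈ FP`.** -/
theorem sd2Str_mem_FP : sd2Str k F0 F1 F2 ℓ t ∈ FP := by
  obtain ⟨f, hf, hfw⟩ := codeFP_sd2Str ℓ t k F0 F1 F2
  have h : f = sd2Str k F0 F1 F2 ℓ t := funext fun w => hfw w
  rw [← h]
  exact hf

/-- **`sd2Str …` is polynomial-time computable** (`IsPolyTime`, the predicate of `SignDeg2SigningFP`). -/
theorem isPolyTime_sd2Str : IsPolyTime (sd2Str k F0 F1 F2 ℓ t) :=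
  (isPolyTime_iff _).mpr (sd2Str_mem_FP ℓ t k F0 F1 F2)

end PolyTime

end Summit.PneNP.PneNP.Theorems.Sd2BlMachine
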